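import Summits.AtomisticToContinuum.FouriersLaw.Theorems.EmbeddedDrudeMourreFGRGapBootstrapA
import Summits.AtomisticToContinuum.FouriersLaw.Theorems.EmbeddedDrudeMourreFGRGapBootstrapL
import Summits.AtomisticToContinuum.FouriersLaw.Theorems.EmbeddedDrudeMourreFGRGapBootstrapD
import Mathlib.MeasureTheory.Function.LocallyIntegrable
import Mathlib.MeasureTheory.Measure.OpenPos

/-!
# FGRGap, line fold-jet-rigidity: stub S2 `stub_nullVectorRegularity`
# (L² null vectors of `q` are a.e. `C¹` collisional invariants — the averaging bootstrap)

Crux `EmbeddedDrudeMourre.FGRGap` (item stmt-AtomisticToContinuum-12595), line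
fold-jet-rigidity. Assembly of the helper files A (form ⇒ a.e. four-point identity), B/C (chart
and core lemma), L (local smooth representative), D (invariance at every real resonance), plus
two generic facts proved here: (i) gluing of local smooth a.e.-representatives on `ℝ` into one
smooth representative inheriting the periods of `f`; (ii) local integrability of `2π`-periodic
functions square integrable on the cell. Result: an odd `2π`-periodic measurable `f` with
`‖f‖²_{L²(cell)} < ∞` and `q(f) = 0` agrees a.e. on the cell with the odd part of its smooth
periodic representative, an odd `C¹` `2π`-periodic collisional invariant.
[LukkarinenSpohn2008 §5]
-/

noncomputable section

open MeasureTheory Set Real Filter Topology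
open scoped ENNReal
open Literature.MathematicalPhysics.KineticTheory.PhononBoltzmann
open Summit.AtomisticToContinuum.FouriersLaw.Theorems.FGRGap

namespace Summit.AtomisticToContinuum.FouriersLaw.Theorems.FGRGap.FoldJetRigidity.Bootstrap

/-! ## Continuous representatives -/

/-- Two continuous functions which agree a.e. on an open set of `ℝ` agree on it. -/
theorem eqOn_of_ae_eq_of_continuous {R S : ℝ → ℝ} (hR : Continuous R) (hS : Continuous S)
    {O : Set ℝ} (hO : IsOpen O) (h : ∀ᵐ y : ℝ, y ∈ O → R y = S y) : EqOn R S O :=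
  Measure.eqOn_open_of_ae_eq ((ae_restrict_iff' hO.measurableSet).2 h) hO hR.continuousOn
    hS.continuousOn

/-- **Gluing local smooth representatives.** If every `x : ℝ` has `ε > 0` and a `C^∞` function
`R` with `f = R` a.e. on `(x - ε, x + ε)`, then there is a `C^∞` function `g : ℝ → ℝ` with
`f = g` a.e. on `ℝ`; moreover every period of `f` is a period of `g`. -/
theorem exists_smooth_ae_eq_of_local {f : ℝ → ℝ}
    (hloc : ∀ x : ℝ, ∃ ε : ℝ, 0 < ε ∧ ∃ R : ℝ → ℝ, ContDiff ℝ ((⊤ : ℕ∞) : WithTop ℕ∞) R ∧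
      ∀ᵐ y : ℝ, y ∈ Ioo (x - ε) (x + ε) → f y = R y) :
    ∃ g : ℝ → ℝ, ContDiff ℝ ((⊤ : ℕ∞) : WithTop ℕ∞) g ∧ (∀ᵐ y : ℝ, f y = g y) ∧
      ∀ c : ℝ, (∀ x, f (x + c) = f x) → ∀ x, g (x + c) = g x := by
  choose ε hε R hR hae using hloc
  -- the candidate: the value at `x` of the representative chosen at `x`
  refine ⟨fun x => R x x, ?_, ?_, ?_⟩
  · -- local agreement of the representatives
    have hagree : ∀ x x' : ℝ, x' ∈ Ioo (x - ε x) (x + ε x) → R x' x' = R x x' := by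
      intro x x' hx'
      have hO : IsOpen (Ioo (x - ε x) (x + ε x) ∩ Ioo (x' - ε x') (x' + ε x')) :=
        isOpen_Ioo.inter isOpen_Ioo
      have hmem : x' ∈ Ioo (x - ε x) (x + ε x) ∩ Ioo (x' - ε x') (x' + ε x') :=
        ⟨hx', by constructor <;> linarith [hε x']⟩
      have hEq : EqOn (R x') (R x) (Ioo (x - ε x) (x + ε x) ∩ Ioo (x' - ε x') (x' + ε x')) := by
        refine eqOn_of_ae_eq_of_continuous (hR x').continuous (hR x).continuous hO ?_
        filter_upwards [hae x, hae x'] with y h1 h2 hy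
        rw [← h2 hy.2, h1 hy.1]
      exact hEq hmem
    rw [contDiff_iff_contDiffAt]
    intro x
    refine (hR x).contDiffAt.congr_of_eventuallyEq ?_
    filter_upwards [Ioo_mem_nhds (show x - ε x < x by linarith [hε x])
      (show x < x + ε x by linarith [hε x])] with x' hx'
    exact hagree x x' hx'
  · -- a.e. equality, through a countable subcover
    have hagree : ∀ x x' : ℝ, x' ∈ Ioo (x - ε x) (x + ε x) → R x' x' = R x x' := by
      intro x x' hx'
      have hO : IsOpen (Ioo (x - ε x) (x + ε x) ∩ Ioo (x' - ε x') (x' + ε x')) :=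
        isOpen_Ioo.inter isOpen_Ioo
      have hmem : x' ∈ Ioo (x - ε x) (x + ε x) ∩ Ioo (x' - ε x') (x' + ε x') :=
        ⟨hx', by constructor <;> linarith [hε x']⟩
      have hEq : EqOn (R x') (R x) (Ioo (x - ε x) (x + ε x) ∩ Ioo (x' - ε x') (x' + ε x')) := by
        refine eqOn_of_ae_eq_of_continuous (hR x').continuous (hR x).continuous hO ?_
        filter_upwards [hae x, hae x'] with y h1 h2 hy
        rw [← h2 hy.2, h1 hy.1]
      exact hEq hmem
    obtain ⟨T, hTc, hTU⟩ := TopologicalSpace.isOpen_iUnion_countable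
      (fun x : ℝ => Ioo (x - ε x) (x + ε x)) fun x => isOpen_Ioo
    have hcover : ∀ y : ℝ, ∃ x ∈ T, y ∈ Ioo (x - ε x) (x + ε x) := by
      intro y
      have hy : y ∈ ⋃ x : ℝ, Ioo (x - ε x) (x + ε x) :=
        mem_iUnion.2 ⟨y, by constructor <;> linarith [hε y]⟩
      rw [← hTU] at hy
      simpa only [mem_iUnion, exists_prop] using hy
    have hall : ∀ᵐ y : ℝ, ∀ x ∈ T, y ∈ Ioo (x - ε x) (x + ε x) → f y = R x y :=
      (ae_ball_iff hTc).2 fun x _ => hae x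
    filter_upwards [hall] with y hy
    obtain ⟨x, hxT, hyx⟩ := hcover y
    rw [hy x hxT hyx, hagree x y hyx]
  · -- periods of `f` are periods of `g`
    intro c hc x
    -- compare `R (x + c) (· + c)` with `R x` near `x`
    set O : Set ℝ := Ioo (x - ε x) (x + ε x) ∩ Ioo (x - ε (x + c)) (x + ε (x + c)) with hO_def
    have hO : IsOpen O := isOpen_Ioo.inter isOpen_Ioo
    have hxO : x ∈ O := ⟨by constructor <;> linarith [hε x],
      by constructor <;> linarith [hε (x + c)]⟩
    have h2 : ∀ᵐ y : ℝ, y + c ∈ Ioo (x + c - ε (x + c)) (x + c + ε (x + c)) →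
        f (y + c) = R (x + c) (y + c) :=
      (measurePreserving_add_right volume c).quasiMeasurePreserving.ae (hae (x + c))
    have hEq : EqOn (fun y => R (x + c) (y + c)) (R x) O := by
      refine eqOn_of_ae_eq_of_continuous (((hR (x + c)).continuous).comp
        (continuous_id.add continuous_const)) (hR x).continuous hO ?_
      filter_upwards [hae x, h2] with y h1 h2 hy
      have hy2 : y + c ∈ Ioo (x + c - ε (x + c)) (x + c + ε (x + c)) := by
        constructor <;> linarith [hy.2.1, hy.2.2]
      show R (x + c) (y + c) = R x y
      rw [← h2 hy2, hc y, h1 hy.1]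
    exact hEq hxO

/-! ## Local integrability of periodic square-integrable functions -/

/-- A `2π`-periodic measurable function with `‖f‖²_{L²(cell)} < ∞` is integrable on every
translate `(-π, π] + 2πn` of the cell. -/
theorem integrableOn_cell_add {f : ℝ → ℝ} (hf_per : Function.Periodic f (2 * π))
    (hf_meas : Measurable f) (hf2 : cellNormSq f < ∞) (n : ℤ) :
    IntegrableOn f (Ioc (-π + n * (2 * π)) (π + n * (2 * π))) := by
  -- integrability on the cell from `L²` and finiteness of the measure
  have hcell : IntegrableOn f (Ioc (-π) π) := by
    have hmem : MemLp f 2 (volume.restrict (Ioc (-π) π)) := by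
      refine ⟨hf_meas.aestronglyMeasurable, ?_⟩
      rw [eLpNorm_lt_top_iff_lintegral_rpow_enorm_lt_top (by norm_num) (by norm_num)]
      simp only [ENNReal.toReal_ofNat, ENNReal.rpow_ofNat]
      unfold cellNormSq at hf2
      convert hf2 using 1
      refine lintegral_congr fun k => ?_
      rw [← ofReal_norm, ← ENNReal.ofReal_pow (norm_nonneg _), Real.norm_eq_abs,
        sq_abs]
    haveI : IsFiniteMeasure (volume.restrict (Ioc (-π) π)) := by
      refine ⟨?_⟩
      rw [Measure.restrict_apply_univ, Real.volume_Ioc]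
      exact ENNReal.ofReal_lt_top
    exact hmem.integrable (by norm_num)
  -- translate
  have hmp : MeasurePreserving (fun x : ℝ => x + n * (2 * π)) volume volume :=
    measurePreserving_add_right volume _
  have hme : MeasurableEmbedding (fun x : ℝ => x + n * (2 * π)) :=
    (MeasurableEquiv.addRight ((n : ℝ) * (2 * π))).measurableEmbedding
  have hpre : (fun x : ℝ => x + n * (2 * π)) ⁻¹' (Ioc (-π + n * (2 * π)) (π + n * (2 * π))) =
      Ioc (-π) π := by
    ext x
    simp only [mem_preimage, mem_Ioc]
    constructor <;> rintro ⟨h1, h2⟩ <;> constructor <;> linarith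
  have hcomp : f ∘ (fun x : ℝ => x + n * (2 * π)) = f := by
    funext x
    exact hf_per.int_mul n x
  rw [← hmp.integrableOn_comp_preimage hme, hpre, hcomp]
  exact hcell

/-- **Local integrability.** A `2π`-periodic measurable function with `‖f‖²_{L²(cell)} < ∞` is
locally integrable on `ℝ`. -/
theorem locallyIntegrable_of_periodic {f : ℝ → ℝ} (hf_per : Function.Periodic f (2 * π))
    (hf_meas : Measurable f) (hf2 : cellNormSq f < ∞) : LocallyIntegrable f volume := by
  rw [locallyIntegrable_iff]
  intro K hK
  obtain ⟨r, hr⟩ := hK.isBounded.subset_closedBall 0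
  -- finitely many translates of the cell cover `closedBall 0 r`
  obtain ⟨N, hN⟩ := exists_nat_gt (r / (2 * π) + 1)
  have hcov : Metric.closedBall (0 : ℝ) r ⊆
      ⋃ n ∈ Set.Icc (-(N : ℤ)) N, Ioc (-π + n * (2 * π)) (π + n * (2 * π)) := by
    intro x hx
    rw [Metric.mem_closedBall, dist_zero_right, Real.norm_eq_abs, abs_le] at hx
    simp only [mem_iUnion, mem_Icc, exists_prop]
    refine ⟨toIocDiv Real.two_pi_pos (-π) x, ?_, ?_⟩
    · have hm := toIocMod_mem_Ioc Real.two_pi_pos (-π) x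
      rw [← self_sub_toIocDiv_zsmul, zsmul_eq_mul] at hm
      set m : ℤ := toIocDiv Real.two_pi_pos (-π) x
      have hπ := Real.pi_pos
      have h1 : ((m : ℝ) - 1) * (2 * π) < r := by linarith [hm.1, hx.2]
      have h2 : -r < ((m : ℝ) + 1) * (2 * π) := by linarith [hm.2, hx.1]
      have h3 : (m : ℝ) - 1 < N := by
        have : ((m : ℝ) - 1) < r / (2 * π) := by
          rw [lt_div_iff₀ (by positivity)]; exact h1
        linarith
      have h4 : -(N : ℝ) < m + 1 := by
        have : -(r / (2 * π)) < (m : ℝ) + 1 := by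
          rw [neg_lt, ← neg_mul, lt_div_iff₀ (by positivity)] at *
          · linarith
        linarith
      refine ⟨?_, ?_⟩
      · have : -(N : ℤ) - 1 < m := by exact_mod_cast (by linarith : -(N : ℝ) - 1 < m)
        omega
      · have : m < (N : ℤ) + 1 := by exact_mod_cast (by linarith : (m : ℝ) < N + 1)
        omega
    · have hm := toIocMod_mem_Ioc Real.two_pi_pos (-π) x
      rw [← self_sub_toIocDiv_zsmul, zsmul_eq_mul] at hm
      constructor <;> linarith [hm.1, hm.2]
  refine IntegrableOn.mono_set ?_ (hr.trans hcov)
  rw [integrableOn_finite_biUnion (Set.finite_Icc _ _)]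
  intro n _
  exact integrableOn_cell_add hf_per hf_meas hf2 n


/-! ## The odd part of the representative -/

/-- The odd part of a smooth `2π`-periodic a.e.-representative of an odd `f` is `C¹`,
`2π`-periodic, odd, and still an a.e.-representative of `f` on the cell. -/
theorem oddPart_repr {f g : ℝ → ℝ} (hf_odd : Function.Odd f)
    (hg : ContDiff ℝ ((⊤ : ℕ∞) : WithTop ℕ∞) g) (hg_per : Function.Periodic g (2 * π))
    (hfg : ∀ᵐ x : ℝ, f x = g x) :
    ContDiff ℝ 1 (fun k => (1 / 2 : ℝ) * (g k - g (-k))) ∧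
      Function.Periodic (fun k => (1 / 2 : ℝ) * (g k - g (-k))) (2 * π) ∧
      Function.Odd (fun k => (1 / 2 : ℝ) * (g k - g (-k))) ∧
      f =ᵐ[volume.restrict (Ioc (-π) π)] fun k => (1 / 2 : ℝ) * (g k - g (-k)) := by
  refine ⟨?_, fun k => ?_, fun k => ?_, ?_⟩
  · have h : ContDiff ℝ ((⊤ : ℕ∞) : WithTop ℕ∞) fun k => (1 / 2 : ℝ) * (g k - g (-k)) :=
      contDiff_const.mul (hg.sub (hg.comp contDiff_neg))
    exact h.of_le (by exact_mod_cast le_top)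
  · show (1 / 2 : ℝ) * (g (k + 2 * π) - g (-(k + 2 * π))) = (1 / 2 : ℝ) * (g k - g (-k))
    rw [hg_per k, neg_add, ← sub_eq_add_neg, hg_per.sub_eq]
  · show (1 / 2 : ℝ) * (g (-k) - g (-(-k))) = -((1 / 2 : ℝ) * (g k - g (-k)))
    rw [neg_neg]; ring
  · have hneg : ∀ᵐ x : ℝ, f (-x) = g (-x) :=
      (Measure.measurePreserving_neg (volume : Measure ℝ)).quasiMeasurePreserving.ae hfg
    refine ae_restrict_of_ae ?_
    filter_upwards [hfg, hneg] with x h1 h2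
    show f x = (1 / 2 : ℝ) * (g x - g (-x))
    rw [← h1, ← h2, hf_odd x]
    ring

end Summit.AtomisticToContinuum.FouriersLaw.Theorems.FGRGap.FoldJetRigidity.Bootstrap

namespace Summit.AtomisticToContinuum.FouriersLaw.Theorems.FGRGap.FoldJetRigidity

/-- **S2 — REGULARITY OF ODD NULL VECTORS (averaging bootstrap), fed by GA and GB.** For
`ω₂ > 0`, a partner map `h` with the GA and GB properties, `a > 0`, `b ≥ 0`: an odd `2π`-periodic
measurable `f` with `‖f‖²_{L²(cell)} < ∞` and `q(f) = 0` agrees a.e. on the cell with an odd `C¹`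
`2π`-periodic collisional invariant. Proof: `q(f) = 0` forces the four-point identity
`f k₁ + f (h k₁ k₃) = f k₃ + f (k₄)` a.e. (file A: two-root structure off the null diagonal,
positive weight off the null equal-velocity curve and vertex zero set); averaging it against a
bump in `k₃` around a general-position partner and substituting `u = φ`, `u = k₄` slice-wise
(files B, C) makes `f` locally a.e. equal to a smooth function (file L); the local representatives
glue to a smooth periodic `g = f` a.e. (file G), which satisfies the identity at every real
resonance (file D: submersion pull-back + continuity; trivial resonances by periodicity); its
odd part is the required `ψ`. [LukkarinenSpohn2008 §5 (arXiv:0704.1607 p.16)] -/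
theorem stub_nullVectorRegularity :
    ∀ ω₂ : ℝ, 0 < ω₂ → ∀ h : ℝ → ℝ → ℝ,
      ((∀ k₁ k₃ : ℝ, h k₁ k₃ ∈ Set.Ioc (-π) π) ∧
        (∀ k₁ k₃ : ℝ, resonanceFn ω₂ k₁ (h k₁ k₃) k₃ = 0) ∧
        (∀ k₁ k₃ : ℝ, h (k₁ + 2 * π) k₃ = h k₁ k₃ ∧ h k₁ (k₃ + 2 * π) = h k₁ k₃) ∧
        (∀ k : ℝ, k ∈ Set.Ioc (-π) π → h k k = k) ∧
        (∀ k₁ k₃ : ℝ, (∀ n : ℤ, k₃ - k₁ ≠ n * (2 * π)) →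
          resonantSet ω₂ k₁ k₃ = {toIocMod Real.two_pi_pos (-π) k₃, h k₁ k₃}) ∧
        (∀ k₁ k₃ : ℝ, (∀ n : ℤ, k₃ - k₁ ≠ n * (2 * π)) →
          (h k₁ k₃ = toIocMod Real.two_pi_pos (-π) k₃ ↔ groupVelocity ω₂ k₃ = groupVelocity ω₂ k₁)) ∧
        (∀ k₁ k₃ : ℝ, groupVelocity ω₂ k₃ ≠ groupVelocity ω₂ k₁ →
          groupVelocity ω₂ (h k₁ k₃) ≠ groupVelocity ω₂ (k₁ + h k₁ k₃ - k₃)) ∧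
        Measurable (Function.uncurry h) ∧
        (∀ k₁ k₃ : ℝ, groupVelocity ω₂ k₃ ≠ groupVelocity ω₂ k₁ →
          ∃ (φ : ℝ × ℝ → ℝ) (U : Set (ℝ × ℝ)), U ∈ 𝓝 (k₁, k₃) ∧ AnalyticOnNhd ℝ φ U ∧
            φ (k₁, k₃) = h k₁ k₃ ∧ (∀ p ∈ U, ∃ n : ℤ, φ p = h p.1 p.2 + n * (2 * π)) ∧
            (∀ p ∈ U, groupVelocity ω₂ p.2 ≠ groupVelocity ω₂ p.1) ∧
            (∀ p ∈ U, HasStrictFDerivAt φ (((groupVelocity ω₂ (p.1 + φ p - p.2) - groupVelocity ω₂ p.1) /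
              (groupVelocity ω₂ (φ p) - groupVelocity ω₂ (p.1 + φ p - p.2))) • ContinuousLinearMap.fst ℝ ℝ ℝ +
            ((groupVelocity ω₂ p.2 - groupVelocity ω₂ (p.1 + φ p - p.2)) /
              (groupVelocity ω₂ (φ p) - groupVelocity ω₂ (p.1 + φ p - p.2))) • ContinuousLinearMap.snd ℝ ℝ ℝ) p))) →
      ((∀ k₁ r : ℝ, 0 ≤ r → ∃ k₃ : ℝ,
          groupVelocity ω₂ k₁ ≠ groupVelocity ω₂ (h k₁ k₃) ∧ groupVelocity ω₂ k₁ ≠ groupVelocity ω₂ k₃ ∧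
          groupVelocity ω₂ k₁ ≠ groupVelocity ω₂ (k₁ + h k₁ k₃ - k₃) ∧ groupVelocity ω₂ (h k₁ k₃) ≠ groupVelocity ω₂ k₃ ∧
          groupVelocity ω₂ (h k₁ k₃) ≠ groupVelocity ω₂ (k₁ + h k₁ k₃ - k₃) ∧ groupVelocity ω₂ k₃ ≠ groupVelocity ω₂ (k₁ + h k₁ k₃ - k₃) ∧
          vertex 1 r k₁ (h k₁ k₃) k₃ ≠ 0) ∧
        MeasureTheory.volume {p : ℝ × ℝ | groupVelocity ω₂ p.2 = groupVelocity ω₂ p.1} = 0 ∧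
        (∀ a b : ℝ, 0 < a → 0 ≤ b →
          MeasureTheory.volume {p : ℝ × ℝ | vertex a b p.1 (h p.1 p.2) p.2 = 0} = 0)) →
      ∀ a b : ℝ, 0 < a → 0 ≤ b → ∀ f : ℝ → ℝ,
        Function.Periodic f (2 * π) → Measurable f → Function.Odd f → cellNormSq f < ∞ →
          boltzmannForm ω₂ a b f = 0 →
            ∃ ψ : ℝ → ℝ, ContDiff ℝ 1 ψ ∧ Function.Periodic ψ (2 * π) ∧ Function.Odd ψ ∧
              IsCollisionalInvariant ω₂ ψ ∧
                f =ᵐ[MeasureTheory.volume.restrict (Set.Ioc (-π) π)] ψ := by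
  intro ω₂ hω h hB hC a b ha hb f hf_per hf_meas hf_odd hf2 hq
  obtain ⟨-, -, h_per, -, h_two, h_triv, h_jac, h_meas, h_lift⟩ := hB
  obtain ⟨h_gen, hC2, hC3⟩ := hC
  -- (1) the a.e. four-point identity
  have hae := Bootstrap.ae_bracket_eq_zero hω h_per h_two h_jac h_meas hC2 (hC3 a b ha hb)
    hf_per hf_meas hq
  -- (2) local smooth representatives
  have hf_loc := Bootstrap.locallyIntegrable_of_periodic hf_per hf_meas hf2
  have hloc := Bootstrap.exists_local_smooth_repr h_lift h_gen hf_per hf_loc hae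
  -- (3) the global smooth periodic representative
  obtain ⟨g, hg, hfg, hgper⟩ := Bootstrap.exists_smooth_ae_eq_of_local hloc
  have hg_per : Function.Periodic g (2 * π) := hgper (2 * π) hf_per
  -- (4) invariance at every real resonance
  have hinv : IsCollisionalInvariant ω₂ g :=
    Bootstrap.isCollisionalInvariant_of_ae h_two h_triv h_jac h_lift hf_per hg_per hg.continuous
      hfg hae
  -- (5) the odd part
  obtain ⟨h1, h2, h3, h4⟩ := Bootstrap.oddPart_repr hf_odd hg hg_per hfg
  exact ⟨fun k => (1 / 2 : ℝ) * (g k - g (-k)), h1, h2, h3, hinv.oddPart, h4⟩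

end Summit.AtomisticToContinuum.FouriersLaw.Theorems.FGRGap.FoldJetRigidity

end
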